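import Mathlib
import Summits.Ventures.HodgeRepro2.T5LocalNormIndex
import Summits.Ventures.HodgeRepro2.T5NormCharConductor
import Summits.Ventures.HodgeRepro2.T5RamifiedOddConductor
import Summits.Ventures.HodgeRepro2.T6N5TateTwist
import Summits.Ventures.HodgeRepro2.T6N5Hyp
import Summits.Ventures.HodgeRepro2.T6N5LocalDatum
import Summits.Ventures.HodgeRepro2.T6N5LocalHyp
import Summits.Ventures.HodgeRepro2.T6N5Local
import Summits.Ventures.HodgeRepro2.T6N5LocalWeil
import Summits.Ventures.HodgeRepro2.T6N5LocalCharDatum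
import Summits.Ventures.HodgeRepro2.T6N5LocalInertHyp
import Summits.Ventures.HodgeRepro2.T6N5LocalInert
import Summits.Ventures.HodgeRepro2.T6N5LocalInertWeil
import Summits.Ventures.HodgeRepro2.T6N5LocalRamHyp
import Summits.Ventures.HodgeRepro2.T6N5LocalRam
import Summits.Ventures.HodgeRepro2.T6N5LocalRamWeil
import Summits.Ventures.HodgeRepro2.T6N5LocalInertCompletion
import Summits.Ventures.HodgeRepro2.T6N5LocalRamCompletion
import Summits.Ventures.HodgeRepro2.T6N5LocalInertOnCompletion
import Summits.Ventures.HodgeRepro2.T6N5LocalRamOnCompletion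
import Summits.Ventures.HodgeRepro2.T6N5LocalRamOnCompletionAll
import Summits.Ventures.HodgeRepro2.T6N5LocalOnCompletionIndex
import Summits.Ventures.HodgeRepro2.T6N5LocalTateChars
import Summits.Ventures.HodgeRepro2.T6N5LocalInertTateSide
import Summits.Ventures.HodgeRepro2.T6N5LocalRamTateSide

/-!
# T6N5LocalOnCompletionWeil — Tier 6, M2 sub-step N5 (t6-p8's half): THE PER-PLACE STATEMENTS OF RECORD —
Theorem N5.T2 on Mathlib's completions with the Tate side modelled AND (A1) discharged from a carried Weil
representation

`T6N5LocalInertWeil.InertWeilDatum.N5Local_main_inert_weil` / `T6N5LocalRamWeil.RamWeilDatum.N5Local_main_ram_weil`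
solve the coupled local system with the binder (A1) discharged from a carried Weil representation (theta predicate
DEFINED as «the `α`-isotypic component of `ω_{V_s,W,ι̃,ψ}|_{U(V_s)}` is non-zero», p4's `T5SmoothIsotypic`).
`T6N5LocalInertTateSide` / `T6N5LocalRamTateSide` model the Tate side on the completions with every Tate-side datum
condition a theorem. This file puts the two together: `mkInertWeil` / `mkRamWeil` are the Weil data over the
completion data (`D := mkInert … (mkTateSide …)` resp. `mkRam … (mkTateSideRam …)`, the Weil carrier
`WeilCarrier` = `U(V) = E¹` with the two representations and `α ↦ α_K`), and
* `N5Local_main_inert_completion_weil` — Theorem N5.T2 at an inert place — has hypotheses EXACTLY: the place data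
  (`[L_w : K_v] = 2`, `ϖ` irreducible in `O_{L_w}`, inertia degree `≥ 2`, `σ ≠ 1`), the datum's `ψ_δ` (continuous,
  non-trivial, trivial on `K_v`), the three printed displays on the ε-factor parameter (`hG` GGP-ex Prop. 3.1, `hT`
  Tate (3.2.2)–(3.2.3), `h35` BFGYYZ Thm 3.5), the properties of the carried Weil representations (non-zero,
  smooth, `j(F_v^×) = 1`), and the Weil-side data (`ϵ_δ(W) = 1`, `χ_W` conjugate-symplectic);
* `N5Local_main_ram_completion_weil` — the same at EVERY finite ramified place (tame or wild) with the displays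
  `hT6` (Tate (3.2.6.3)), `hG` (GGP Prop. 5.1 (2)), `h35`.
Every character-side datum condition (`hU`, `hμ`, `hβ`, `hodd`, `heven`, `hη`, the norm index) and every Tate-side
condition (`hc`, `hψδ`, `ht`, `hηt`, `hin`, `hψ0`, `hω`, `hconj`) is a kernel theorem here; (A1) is the Weil
carrier's; case (iii) is `T6N5LocalInert` / `T6N5LocalRam`.
README §8(d): uses an L-value-free non-vanishing device: NO.
-/

namespace Summit.Ventures.HodgeRepro2.T6.N5LocalOnCompletionWeil

open Summit.Ventures.HodgeRepro2 IsDedekindDomain HeightOneSpectrum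
  Summit.Ventures.HodgeRepro2.T6.N5LocalDatum Summit.Ventures.HodgeRepro2.T6.N5LocalWeil
  Summit.Ventures.HodgeRepro2.T6.N5LocalCharDatum Summit.Ventures.HodgeRepro2.T6.N5LocalInertDatum
  Summit.Ventures.HodgeRepro2.T6.N5LocalRamDatum Summit.Ventures.HodgeRepro2.T6.N5Local
  Summit.Ventures.HodgeRepro2.T6.N5LocalInertWeil Summit.Ventures.HodgeRepro2.T6.N5LocalRamWeil
  Summit.Ventures.HodgeRepro2.T6.Hyp Summit.Ventures.HodgeRepro2.T6.N5LocalInertCompletion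
  Summit.Ventures.HodgeRepro2.T6.N5LocalRamCompletion Summit.Ventures.HodgeRepro2.T6.N5LocalInertOnCompletion
  Summit.Ventures.HodgeRepro2.T6.N5LocalRamOnCompletion Summit.Ventures.HodgeRepro2.T6.N5LocalTateChars
  Summit.Ventures.HodgeRepro2.T6.N5LocalInertTateSide Summit.Ventures.HodgeRepro2.T6.N5LocalRamTateSide

-- `K`, `L` in `Type` (universe `0`).
variable {K : Type} [Field K] [NumberField K] (v : HeightOneSpectrum (NumberField.RingOfIntegers K))
  {L : Type} [Field L] [NumberField L] [Algebra K L] (w : HeightOneSpectrum (NumberField.RingOfIntegers L))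
  [w.asIdeal.LiesOver v.asIdeal]
  [ContinuousSMul (v.adicCompletion K) (w.adicCompletion L)]
  [IsScalarTower K (v.adicCompletion K) (w.adicCompletion L)]

noncomputable section

/-- The carried Weil representations (data only): `U(V) = E¹_v` as an additive abelian group, the spaces and the
actions of `ω_{V_s,W,ι̃,ψ}|_{U(V_s)}` for the two hermitian lines, and `α ↦ α_K = α ∘ j`. -/
structure WeilCarrier (E : Type) [CommGroup E] where
  /-- `U(V) = E¹_v` as an additive abelian group. -/
  A : Type
  [instA : AddCommGroup A]
  /-- the space of the Weil representation of the line `V_s` restricted to `U(V_s)`. -/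
  Wsp : ℤˣ → Type
  [instW : ∀ s, AddCommGroup (Wsp s)]
  [instWm : ∀ s, Module ℂ (Wsp s)]
  /-- the Weil representation `ω_{V_s,W,ι̃,ψ}` restricted to `U(V_s) = E¹_v`. -/
  ωWeil : ∀ s, Representation ℂ (Multiplicative A) (Wsp s)
  /-- `α ↦ α_K = α ∘ j`. -/
  ofOne : AddChar A ℂ → (E →* ℂˣ)

attribute [instance] WeilCarrier.instA WeilCarrier.instW WeilCarrier.instWm

/-! ### Inert places -/

section Inert

variable (h2 : Module.finrank (v.adicCompletion K) (w.adicCompletion L) = 2)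
  {ϖ : v.adicCompletionIntegers K} (hϖ : Irreducible ϖ)
  (hϖS : Irreducible (algebraMap (v.adicCompletionIntegers K) (w.adicCompletionIntegers L) ϖ))
  (σ : Gal(w.adicCompletion L/v.adicCompletion K)) (hσ : σ ≠ 1)
  (P : TateParams (w.adicCompletion L)ˣ (PsiC w) ℝ) (ψδ : PsiC w)
  (hK : ∀ a : v.adicCompletion K, ψδ.1 (algebraMap (v.adicCompletion K) (w.adicCompletion L) a) = 1)
  (C : WeilCarrier (w.adicCompletion L)ˣ)

/-- The inert Weil datum over the completion data with the Tate side modelled. -/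
abbrev mkInertWeil : InertWeilDatum where
  D := mkInert v w ϖ σ (T5LocalNormIndex.index_normGroup_eq_two v w σ h2 hσ)
    (mkTateSide v w h2 hϖ hϖS σ hσ P ψδ hK)
  A := C.A
  Wsp := C.Wsp
  ωWeil := C.ωWeil
  ofOne := C.ofOne

/-- THEOREM N5.T2 AT AN INERT PLACE — THE STATEMENT OF RECORD: on Mathlib's completions, with the Tate side
modelled (`T6N5LocalInertTateSide`), every character-side and Tate-side datum condition a theorem, case (iii) from
`T6N5LocalInert`, and (A1) from the carried Weil representation. Hypotheses: the place data, `ψ_δ`, the displays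
`hG` / `hT` / `h35`, the Weil carrier's non-vanishing / smoothness / `j(F_v^×) = 1`, and `ϵ_δ(W) = 1`, `χ_W`
conjugate-symplectic. -/
theorem N5Local_main_inert_completion_weil
    (hf : 2 ≤ (Ideal.span {ϖ}).inertiaDeg'
      (Ideal.span {algebraMap (v.adicCompletionIntegers K) (w.adicCompletionIntegers L) ϖ}))
    (hG : GGP2012ex_Prop3_1 (mkInertWeil v w h2 hϖ hϖS σ hσ P ψδ hK C).D)
    (hT : Tate1979_3_2_2_3 P.epsT (fun ξ a => ((ξ a : ℂˣ) : ℂ)) (twist w) (fun r m => r * m) (nrm w)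
      (fun _ => True))
    (h35 : BFGYYZ2025_Thm3_5 (mkInertWeil v w h2 hϖ hϖS σ hσ P ψδ hK C).toWeil.toLocalSignDatum)
    (hsm : ∀ s, (mkInertWeil v w h2 hϖ hϖS σ hσ P ψδ hK C).toWeil.IsSmoothCompact s)
    [∀ s, Nontrivial (C.Wsp s)]
    (hofOne : ∀ α, (mkInertWeil v w h2 hϖ hϖS σ hσ P ψδ hK C).toWeil.toLocalSignDatum.IsCO (C.ofOne α))
    (hW : P.epsdW = 1)
    (hχW : (mkInertWeil v w h2 hϖ hϖS σ hσ P ψδ hK C).toWeil.toLocalSignDatum.IsCS P.χW) :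
    ∃ ξ : Fin 4 → (w.adicCompletion L)ˣ →* ℂˣ,
      LocalSolution (mkInertWeil v w h2 hϖ hϖS σ hσ P ψδ hK C).toWeil.toLocalSignDatum ξ := by
  refine (mkInertWeil v w h2 hϖ hϖS σ hσ P ψδ hK C).N5Local_main_inert_weil hG hT
    (conventions_mk v w h2 hϖ hϖS σ hσ P ψδ hK) (U_antitone v w ϖ) (ψδ_eq_twist v w h2 hϖ hϖS σ hσ ψδ hK)
    (tE_mem_Fsub v w h2 hϖ hϖS σ hσ ψδ hK) (ηF_tE v w h2 hϖ hϖS σ hσ ψδ hK) ⟨h2, hϖS⟩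
    (isNormalisedC_ψ0C v w h2 hϖ hϖS) ?_ ?_ h35 hsm hofOne hW
    (N5LocalInertOnCompletion.ηF_mul_self v w σ (T5LocalNormIndex.index_normGroup_eq_two v w σ h2 hσ)) hχW
  · refine ⟨μ w, ?_, μ_mem_U_zero v w ϖ⟩
    rw [CharDatum.isCS_iff]
    intro x
    exact μ_eq_ηF v w σ hσ h2 hϖ hϖS _ x
  · intro n hn
    obtain ⟨β, hβF, hβs, hβc⟩ := exists_CO_exact_level v w hϖ hϖS hf n hn
    refine ⟨β, ?_, hβs, hβc⟩
    rw [CharDatum.isCO_iff]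
    intro x
    exact hβF x.1 x.2

end Inert

/-! ### Ramified places (tame or wild) -/

section Ram

variable (h2 : Module.finrank (v.adicCompletion K) (w.adicCompletion L) = 2)
  {ϖ : v.adicCompletionIntegers K} (hϖ : Irreducible ϖ) {π : w.adicCompletionIntegers L} (hπ : Irreducible π)
  (hram : ¬ Irreducible (algebraMap (v.adicCompletionIntegers K) (w.adicCompletionIntegers L) ϖ))
  (σ : Gal(w.adicCompletion L/v.adicCompletion K)) (hσ : σ ≠ 1)
  (P : TateParams (w.adicCompletion L)ˣ (PsiC w) ℝ) (ψδ : PsiC w)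
  (C : WeilCarrier (w.adicCompletion L)ˣ)

/-- The ramified Weil datum over the completion data with the Tate side modelled. -/
abbrev mkRamWeil : RamWeilDatum where
  D := mkRam v w hπ σ (T5LocalNormIndex.index_normGroup_eq_two v w σ h2 hσ) (mkTateSideRam v w σ P ψδ)
  A := C.A
  Wsp := C.Wsp
  ωWeil := C.ωWeil
  ofOne := C.ofOne

include hϖ hram in
include hϖ hram in
/-- THEOREM N5.T2 AT EVERY FINITE RAMIFIED PLACE (tame or wild) — THE STATEMENT OF RECORD: on Mathlib's
completions, with the Tate side modelled (`T6N5LocalRamTateSide`), every character-side and Tate-side datum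
condition a theorem (`hodd` at wild places from p4's `T5RamifiedOddConductor`), case (iii) from `T6N5LocalRam`,
and (A1) from the carried Weil representation. Hypotheses: the ramified place data, `ψ_δ` (trivial on `K_v`), the
displays `hT6` / `hG` / `h35`, the Weil carrier's properties, and `ϵ_δ(W) = 1`, `χ_W` conjugate-symplectic. -/
theorem N5Local_main_ram_completion_weil
    (hK : ∀ a : v.adicCompletion K, ψδ.1 (algebraMap (v.adicCompletion K) (w.adicCompletion L) a) = 1)
    (hT6 : Tate1979_3_2_6_3 (mkRamWeil v w h2 hπ σ hσ P ψδ C).D)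
    (hG : GGP2012_Prop5_1_2 (mkRamWeil v w h2 hπ σ hσ P ψδ C).D)
    (h35 : BFGYYZ2025_Thm3_5 (mkRamWeil v w h2 hπ σ hσ P ψδ C).toWeil.toLocalSignDatum)
    (hsm : ∀ s, (mkRamWeil v w h2 hπ σ hσ P ψδ C).toWeil.IsSmoothCompact s)
    [∀ s, Nontrivial (C.Wsp s)]
    (hofOne : ∀ α, (mkRamWeil v w h2 hπ σ hσ P ψδ C).toWeil.toLocalSignDatum.IsCO (C.ofOne α))
    (hW : P.epsdW = 1)
    (hχW : (mkRamWeil v w h2 hπ σ hσ P ψδ C).toWeil.toLocalSignDatum.IsCS P.χW) :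
    ∃ ξ : Fin 4 → (w.adicCompletion L)ˣ →* ℂˣ,
      LocalSolution (mkRamWeil v w h2 hπ σ hσ P ψδ C).toWeil.toLocalSignDatum ξ := by
  refine (mkRamWeil v w h2 hπ σ hσ P ψδ C).N5Local_main_ram_weil hT6 hG (Uπ_antitone w π)
    (omega_half_unramified w π) (isConjInvC_of_trivial_on_base v w h2 σ hσ ψδ hK) ?_ ?_ ?_ h35 hsm hofOne hW
    (N5LocalRamOnCompletion.ηF_mul_self v w σ (T5LocalNormIndex.index_normGroup_eq_two v w σ h2 hσ)) hχW
  · -- `hμ`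
    refine ⟨μ w, ?_, μ_mem_Uπ_zero w π, ?_, μ_sq w⟩
    · rw [CharDatum.isCO_iff]
      intro x
      exact μ_isCO v w h2 hϖ hπ hram x.1 x.2
    · show ((μ w (T5LocalFieldUnitsDecomposition.uniformizerUnit π hπ) : ℂˣ) : ℂ) = -1
      rw [μ_uniformizer w hπ]
      rfl
  · -- `hodd` (every ramified place: p4's `T5RamifiedOddConductor`)
    obtain ⟨ω, hωF, hωs, hωc⟩ :=
      T5RamifiedOddConductor.exists_CS_odd_level_of_ramified v w h2 hϖ hπ hram σ hσ
        (T5LocalNormIndex.index_normGroup_eq_two v w σ h2 hσ)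
    refine ⟨ω, ?_, hωs, hωc⟩
    rw [CharDatum.isCS_iff]
    intro x
    exact hωF x
  · -- `heven`
    intro k
    obtain ⟨β, hβF, hβs, hβc⟩ := exists_CO_exact_even_level v w h2 hϖ hπ hram k
    refine ⟨β, ?_, hβs, ?_, ?_⟩
    · rw [CharDatum.isCO_iff]
      intro x
      exact hβF x.1 x.2
    · show Even (T5ConductorArithmetic.conductor (Uπ w π) β)
      rw [hβc]
      exact ⟨k + 1, by ring⟩
    · show k < T5ConductorArithmetic.conductor (Uπ w π) β
      rw [hβc]
      omega

end Ram

end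

end Summit.Ventures.HodgeRepro2.T6.N5LocalOnCompletionWeil
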